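import Literature.NumberTheory.EllipticCurves.KrausOesterle1992.TorsionCongruenceCriterionHasseWeil
import Literature.NumberTheory.EllipticCurves.KrausOesterle1992.TraceCongruenceOfTorsionIsoProofs
import Literature.NumberTheory.EllipticCurves.LocalTorsionMultiplicativeProofs
import HarnessLib

/-!
# Kraus–Oesterlé 1992, Proposition 4 in Hasse–Weil currency — proofs (forwarders and variants)

`Proofs` companion (THEOREMS ONLY — nothing defined, no named fact, no `sorry`; axioms of every
theorem `propext`, `Classical.choice`, `Quot.sound`) of
`KrausOesterle1992/TorsionCongruenceCriterionHasseWeil.lean`, whose named fact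
`prop4_torsionIso_of_congruences_hasseWeil` is the print-faithful twin (ARM-P target T-Q41-1,
REGISTER R-20) of A30 `prop4_torsionIso_of_congruences`: the `v_ℓ(NN') = 1` conjunct of Prop. 4
(ii) over the Hasse–Weil coefficients `W.LFunction ℓ * W'.LFunction ℓ` (A. Kraus, J. Oesterlé,
Math. Ann. 293 (1992) 259–275, §3 p. 262, Prop. 4 pp. 263–264; p. 263 L8–9 «Comme on a `a'_ℓ = ±1`,
on a `a_ℓ a'_ℓ ≡ ℓ + 1 mod p`»). Typed by the literature-typing layer (seat bsd-littype-07 g6).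
HONEST FRAMING: nothing here bears on BSD; these are the one-line compositions consumers need to
re-key from A30 to the twin BY NAME.

## What is proved

* `lFunction_congr_of_prop4_hasseWeil` — twin of the sibling Proofs file's
  `lFunction_congr_of_prop4`: `W[p]` irreducible and the finite list (ii) below `μ(M)/6` (good-prime
  conjunct on `frobeniusTrace`, simple-prime conjunct on `LFunction`) give `a_ℓ(W) = a_ℓ(G)` in
  `ZMod p` at EVERY prime `ℓ ∤ p·N_W·N_G` (`a_ℓ = LFunction ℓ`), via the fact and
  `lFunction_congr_of_addEquiv_geomTorsion` (Prop. 3 (i) ⇒ (iii)). CONDITIONAL on the twin only.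
* `congruenceList_mixed_of_lFunctionList` / `torsionIso_of_congruences_hasseWeil_of_lFunctionList` —
  the ALL-Hasse–Weil spelling of (ii) (both conjuncts over `LFunction`, literally print's `a_ℓ` at
  every prime) implies the twin's mixed list, hence the conclusion: at a prime with
  `v_ℓ(NN') = 0` both curves are good at `ℓ` (`hasGoodReductionAtPrime_of_not_dvd_conductorNorm`)
  and there `LFunction ℓ = frobeniusTrace ℓ` (`LFunction_apply_prime_eq_frobeniusTrace`, Silverman
  AEC Ex. 8.19(a)). So a consumer may display either spelling.
* `lFunction_apply_prime_eq_one_of_hasSplitMultiplicativeReductionAtPrime`,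
  `lFunction_apply_prime_eq_neg_one_of_not_split`, `frobeniusTrace_eq_lFunction_add_one_of_mult` —
  the Literature restatement, PRIME-indexed, of the reader's kernel identities K3a–d (ARM-P sheet
  `D-AUDIT-r07-Q41-KO92-LS18.md` §V8): at a multiplicative prime `ℓ` the Hasse–Weil coefficient is
  `LFunction ℓ = 1` (split) / `−1` (non-split) — Kraus–Oesterlé's Lemme 1, p. 262: «Si `E` a
  réduction multiplicative déployée en `ℓ`, on a `a_ℓ = 1` … non déployée …, `a_ℓ = −1`» — while
  the tree's `frobeniusTrace ℓ = ℓ + 1 − #Ẽ_ns(𝔽_ℓ)` is `LFunction ℓ + 1 ∈ {2, 0}`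
  (`LocalTorsionMult.reductionPointCount_of_mult`, Silverman AEC Ex. 3.5; the place-indexed
  `LFunction_apply_primesEquiv_of_…` of `RootNumberAtkinLehnerSemistableProofs` transported along
  the tree's prime ↔ place bridges). This is the finding F1 itself, citable from Literature.

## References

* [KrausOesterle1992] Math. Ann. 293 (1992): §3 p. 262, p. 263 L8–9, Prop. 4 pp. 263–264 (GDZ
  PPN235181684_0293 scans 268–270).
* [SilvermanAEC2009] §C.16, Ex. 8.19(a).
-/

noncomputable section

open scoped Classical NumberField
open IsDedekindDomain Field WeierstrassCurve
open Literature.NumberTheory.EllipticCurves Literature.NumberTheory.GaloisRepresentations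

namespace Literature.NumberTheory.EllipticCurves.KrausOesterle1992

section WithProp4HasseWeil

/-- **The finite Kraus–Oesterlé criterion in Hasse–Weil currency, composed with Prop. 3 (i) ⇒ (iii):
the congruence list of Prop. 4 (ii) below `μ(M)/6` — good-prime conjunct `p ∣ a_ℓ(W) − a_ℓ(G)`
(`a_ℓ = frobeniusTrace`), simple-prime conjunct `p ∣ a_ℓ(W) a_ℓ(G) − (ℓ+1)` with the HASSE–WEIL
coefficients `a_ℓ = LFunction ℓ` (`= ±1` at the multiplicative curve) — for `W[p]` irreducible,
gives `a_ℓ(W) ≡ a_ℓ(G) (mod p)` at EVERY prime `ℓ ∤ p·N_W·N_G`.** CONDITIONAL on the named fact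
`prop4_torsionIso_of_congruences_hasseWeil` (binder `hKO`), nothing else; twin of
`lFunction_congr_of_prop4`. [cite: KrausOesterle1992, §3 Prop. 4 with Prop. 3 (iii), Math. Ann. 293 pp. 262–264 (GDZ PPN235181684_0293 scans 268–270)] -/
theorem lFunction_congr_of_prop4_hasseWeil (hKO : prop4_torsionIso_of_congruences_hasseWeil)
    (W G : WeierstrassCurve ℚ) [W.IsElliptic] [W.IsGloballyMinimal] [G.IsElliptic]
    [G.IsGloballyMinimal] (p : ℕ) [Fact p.Prime] (hirr : W.HasIrreducibleModPGaloisRep p)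
    (hlist : ∀ (ℓ : ℕ) [Fact ℓ.Prime], 6 * ℓ < gammaZeroIndex (modulus W G) →
      (padicValNat ℓ (W.conductorNorm ℤ * G.conductorNorm ℤ) = 0 →
          (p : ℤ) ∣ W.frobeniusTrace ℓ - G.frobeniusTrace ℓ) ∧
        (padicValNat ℓ (W.conductorNorm ℤ * G.conductorNorm ℤ) = 1 →
          (p : ℤ) ∣ W.LFunction ℓ * G.LFunction ℓ - (ℓ + 1))) :
    ∀ ℓ : ℕ, ℓ.Prime → ¬ (ℓ ∣ p * W.conductorNorm ℤ * G.conductorNorm ℤ) →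
      ((W.LFunction ℓ : ℤ) : ZMod p) = ((G.LFunction ℓ : ℤ) : ZMod p) := by
  obtain ⟨e, he⟩ := hKO W G p hirr hlist
  exact fun ℓ hℓ hndvd ↦ lFunction_congr_of_addEquiv_geomTorsion W G p e he hℓ hndvd

end WithProp4HasseWeil

/-! ### The all-Hasse–Weil spelling of (ii) implies the mixed one -/

section AllHasseWeil

variable (W G : WeierstrassCurve ℚ) [W.IsElliptic] [W.IsGloballyMinimal] [G.IsElliptic]
  [G.IsGloballyMinimal] (p : ℕ)

/-- At a prime `ℓ` with `v_ℓ(N_W·N_G) = 0` both curves have good reduction and the Hasse–Weil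
coefficient is the trace of Frobenius: `LFunction ℓ = frobeniusTrace ℓ` for `W` and for `G`
(`hasGoodReductionAtPrime_of_not_dvd_conductorNorm`, `LFunction_apply_prime_eq_frobeniusTrace`;
Silverman AEC Ex. 8.19(a)). [cite: SilvermanAEC2009, Exercise 8.19(a) (p. 230) and §C.16] -/
theorem lFunction_eq_frobeniusTrace_of_padicValNat_mul_eq_zero (ℓ : ℕ) [hℓ : Fact ℓ.Prime]
    (h0 : padicValNat ℓ (W.conductorNorm ℤ * G.conductorNorm ℤ) = 0) :
    W.LFunction ℓ = W.frobeniusTrace ℓ ∧ G.LFunction ℓ = G.frobeniusTrace ℓ := by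
  have hNW : W.conductorNorm ℤ ≠ 0 := (W.conductorNorm_pos_holds).ne'
  have hNG : G.conductorNorm ℤ ≠ 0 := (G.conductorNorm_pos_holds).ne'
  have hndvd : ¬ ℓ ∣ W.conductorNorm ℤ * G.conductorNorm ℤ := by
    rcases padicValNat.eq_zero_iff.mp h0 with h | h | h
    · exact absurd h hℓ.out.one_lt.ne'
    · exact absurd h (mul_ne_zero hNW hNG)
    · exact h
  have hW : W.HasGoodReductionAtPrime ℓ :=
    hasGoodReductionAtPrime_of_not_dvd_conductorNorm W fun h ↦ hndvd (dvd_mul_of_dvd_left h _)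
  have hG : G.HasGoodReductionAtPrime ℓ :=
    hasGoodReductionAtPrime_of_not_dvd_conductorNorm G fun h ↦ hndvd (dvd_mul_of_dvd_right h _)
  exact ⟨W.LFunction_apply_prime_eq_frobeniusTrace ℓ hW, G.LFunction_apply_prime_eq_frobeniusTrace ℓ hG⟩

/-- **The all-Hasse–Weil list implies the mixed list.** If the Prop. 4 (ii) list holds with BOTH
conjuncts over the Hasse–Weil coefficients `LFunction ℓ` (literally print's `a_ℓ, a'_ℓ` at every
prime), then it holds in the twin's spelling (good-prime conjunct over `frobeniusTrace`).
[cite: KrausOesterle1992, Prop. 4 (ii), p. 264 L1–3] -/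
theorem congruenceList_mixed_of_lFunctionList
    (hlist : ∀ (ℓ : ℕ) [Fact ℓ.Prime], 6 * ℓ < gammaZeroIndex (modulus W G) →
      (padicValNat ℓ (W.conductorNorm ℤ * G.conductorNorm ℤ) = 0 →
          (p : ℤ) ∣ W.LFunction ℓ - G.LFunction ℓ) ∧
        (padicValNat ℓ (W.conductorNorm ℤ * G.conductorNorm ℤ) = 1 →
          (p : ℤ) ∣ W.LFunction ℓ * G.LFunction ℓ - (ℓ + 1))) :
    ∀ (ℓ : ℕ) [Fact ℓ.Prime], 6 * ℓ < gammaZeroIndex (modulus W G) →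
      (padicValNat ℓ (W.conductorNorm ℤ * G.conductorNorm ℤ) = 0 →
          (p : ℤ) ∣ W.frobeniusTrace ℓ - G.frobeniusTrace ℓ) ∧
        (padicValNat ℓ (W.conductorNorm ℤ * G.conductorNorm ℤ) = 1 →
          (p : ℤ) ∣ W.LFunction ℓ * G.LFunction ℓ - (ℓ + 1)) := by
  intro ℓ _ hℓ
  refine ⟨fun h0 ↦ ?_, (hlist ℓ hℓ).2⟩
  obtain ⟨hW, hG⟩ := lFunction_eq_frobeniusTrace_of_padicValNat_mul_eq_zero W G ℓ h0
  rw [← hW, ← hG]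
  exact (hlist ℓ hℓ).1 h0

/-- **Prop. 4 (ii) ⇒ (i) from the all-Hasse–Weil list.** For globally minimal `W, G`, `W[p]`
irreducible, and the list (ii) with both conjuncts over `LFunction`: a `Γ_ℚ`-equivariant
`W[p] ≃+ G[p]`, from the named fact `prop4_torsionIso_of_congruences_hasseWeil`.
[cite: KrausOesterle1992, Prop. 4 (ii) ⇒ (i), pp. 263–264] -/
theorem torsionIso_of_lFunctionList (hKO : prop4_torsionIso_of_congruences_hasseWeil)
    [Fact p.Prime] (hirr : W.HasIrreducibleModPGaloisRep p)
    (hlist : ∀ (ℓ : ℕ) [Fact ℓ.Prime], 6 * ℓ < gammaZeroIndex (modulus W G) →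
      (padicValNat ℓ (W.conductorNorm ℤ * G.conductorNorm ℤ) = 0 →
          (p : ℤ) ∣ W.LFunction ℓ - G.LFunction ℓ) ∧
        (padicValNat ℓ (W.conductorNorm ℤ * G.conductorNorm ℤ) = 1 →
          (p : ℤ) ∣ W.LFunction ℓ * G.LFunction ℓ - (ℓ + 1))) :
    ∃ e : geomTorsion W (p : ℤ) ≃+ geomTorsion G (p : ℤ),
      ∀ (σ : Field.absoluteGaloisGroup ℚ) (P : geomTorsion W (p : ℤ)), e (σ • P) = σ • e P :=
  hKO W G p hirr (congruenceList_mixed_of_lFunctionList W G p hlist)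

/-- The same through Prop. 3 (i) ⇒ (iii): the all-Hasse–Weil list below the bound gives
`a_ℓ(W) = a_ℓ(G)` in `ZMod p` at every prime `ℓ ∤ p·N_W·N_G`.
[cite: KrausOesterle1992, §3 Prop. 4 with Prop. 3 (iii), pp. 262–264] -/
theorem lFunction_congr_of_lFunctionList (hKO : prop4_torsionIso_of_congruences_hasseWeil)
    [Fact p.Prime] (hirr : W.HasIrreducibleModPGaloisRep p)
    (hlist : ∀ (ℓ : ℕ) [Fact ℓ.Prime], 6 * ℓ < gammaZeroIndex (modulus W G) →
      (padicValNat ℓ (W.conductorNorm ℤ * G.conductorNorm ℤ) = 0 →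
          (p : ℤ) ∣ W.LFunction ℓ - G.LFunction ℓ) ∧
        (padicValNat ℓ (W.conductorNorm ℤ * G.conductorNorm ℤ) = 1 →
          (p : ℤ) ∣ W.LFunction ℓ * G.LFunction ℓ - (ℓ + 1))) :
    ∀ ℓ : ℕ, ℓ.Prime → ¬ (ℓ ∣ p * W.conductorNorm ℤ * G.conductorNorm ℤ) →
      ((W.LFunction ℓ : ℤ) : ZMod p) = ((G.LFunction ℓ : ℤ) : ZMod p) :=
  lFunction_congr_of_prop4_hasseWeil hKO W G p hirr (congruenceList_mixed_of_lFunctionList W G p hlist)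

end AllHasseWeil


/-! ### Kraus–Oesterlé's Lemme 1 in the tree's two currencies: `LFunction = ±1`,
`frobeniusTrace = LFunction + 1` at a multiplicative prime (the reader's K3a–d, prime-indexed) -/

section MultiplicativePrime

open Rat.HeightOneSpectrum

variable (W : WeierstrassCurve ℚ) [W.IsElliptic] (ℓ : ℕ) [hℓ : Fact ℓ.Prime]

/-- **`a_ℓ = 1` at a prime of split multiplicative reduction** (Kraus–Oesterlé, Lemme 1, p. 262:
«Si `E` a réduction multiplicative déployée en `ℓ`, on a `a_ℓ = 1`»; Silverman AEC §C.16: local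
factor `1 − T`), for Mathlib's `WeierstrassCurve.LFunction` and the prime-indexed reduction type
`HasSplitMultiplicativeReductionAtPrime ℓ` (the `ℤ_ℓ`-minimal model of `W/ℚ_ℓ`); the place-indexed
tree theorem `LFunction_apply_primesEquiv_of_hasSplitMultiplicativeReductionAt` transported along
`hasSplitMultiplicativeReductionAtPrime_iff_hasSplitMultiplicativeReductionAt`.
[cite: KrausOesterle1992, §3 Lemme 1, p. 262 (GDZ scan 268)] -/
theorem lFunction_apply_prime_eq_one_of_hasSplitMultiplicativeReductionAtPrime
    (h : W.HasSplitMultiplicativeReductionAtPrime ℓ) : W.LFunction ℓ = 1 := by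
  obtain ⟨v, hv⟩ : ∃ v : HeightOneSpectrum (𝓞 ℚ), (primesEquiv v : ℕ) = ℓ :=
    ⟨primesEquiv.symm ⟨ℓ, hℓ.out⟩, by rw [Equiv.apply_symm_apply]⟩
  subst hv
  exact W.LFunction_apply_primesEquiv_of_hasSplitMultiplicativeReductionAt
    ((W.hasSplitMultiplicativeReductionAtPrime_iff_hasSplitMultiplicativeReductionAt v).mp h)

/-- **`a_ℓ = −1` at a prime of non-split multiplicative reduction** (Kraus–Oesterlé, Lemme 1,
p. 262: «si `E` a réduction multiplicative non déployée en `ℓ`, on a `a_ℓ = −1`»; Silverman AEC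
§C.16: local factor `1 + T`), prime-indexed, transported along the tree's bridges
`hasMultiplicativeReductionAtPrime_iff_hasMultiplicativeReductionAt_ringOfIntegers` and
`hasSplitMultiplicativeReductionAtPrime_iff_hasSplitMultiplicativeReductionAt`.
[cite: KrausOesterle1992, §3 Lemme 1, p. 262 (GDZ scan 268)] -/
theorem lFunction_apply_prime_eq_neg_one_of_not_split
    (h : W.HasMultiplicativeReductionAtPrime ℓ) (hs : ¬ W.HasSplitMultiplicativeReductionAtPrime ℓ) :
    W.LFunction ℓ = -1 := by
  obtain ⟨v, hv⟩ : ∃ v : HeightOneSpectrum (𝓞 ℚ), (primesEquiv v : ℕ) = ℓ :=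
    ⟨primesEquiv.symm ⟨ℓ, hℓ.out⟩, by rw [Equiv.apply_symm_apply]⟩
  subst hv
  exact W.LFunction_apply_primesEquiv_of_hasMultiplicativeReductionAt_of_not_split
    ((W.hasMultiplicativeReductionAtPrime_iff_hasMultiplicativeReductionAt_ringOfIntegers v).mp h)
    (fun hs' ↦ hs
      ((W.hasSplitMultiplicativeReductionAtPrime_iff_hasSplitMultiplicativeReductionAt v).mpr hs'))

/-- **`a_ℓ = ±1` at a multiplicative prime** (Kraus–Oesterlé, Lemme 1, p. 262; used at p. 263
L8–9 «Comme on a `a'_ℓ = ±1`»). [cite: KrausOesterle1992, §3 Lemme 1, p. 262; p. 263 L8–9] -/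
theorem lFunction_apply_prime_eq_one_or_eq_neg_one_of_mult
    (h : W.HasMultiplicativeReductionAtPrime ℓ) : W.LFunction ℓ = 1 ∨ W.LFunction ℓ = -1 := by
  by_cases hs : W.HasSplitMultiplicativeReductionAtPrime ℓ
  · exact Or.inl (lFunction_apply_prime_eq_one_of_hasSplitMultiplicativeReductionAtPrime W ℓ hs)
  · exact Or.inr (lFunction_apply_prime_eq_neg_one_of_not_split W ℓ h hs)

/-- **The finding F1 as a Literature theorem: at a multiplicative prime the tree's `frobeniusTrace`
is the Hasse–Weil coefficient PLUS ONE.** For a globally minimal `W` multiplicative at `ℓ`,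
`frobeniusTrace W ℓ = ℓ + 1 − #Ẽ_ns(𝔽_ℓ)` equals `LFunction ℓ + 1` (`= 2` split, `= 0` non-split:
`LocalTorsionMult.reductionPointCount_of_mult`, Silverman AEC Ex. 3.5, against Lemme 1's `±1`). Hence
A30's `v_ℓ(NN') = 1` conjunct, spelled with `frobeniusTrace`, is not print's clause at such `ℓ`
(ARM-P REGISTER R-20). [cite: KrausOesterle1992, §3 Lemme 1, p. 262; Prop. 4 (ii), p. 264 L1–3] -/
theorem frobeniusTrace_eq_lFunction_add_one_of_mult [W.IsGloballyMinimal]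
    (h : W.HasMultiplicativeReductionAtPrime ℓ) : W.frobeniusTrace ℓ = W.LFunction ℓ + 1 := by
  obtain ⟨hsplit, hnonsplit⟩ := LocalTorsionMult.reductionPointCount_of_mult W ℓ h
  by_cases hs : W.HasSplitMultiplicativeReductionAtPrime ℓ
  · rw [lFunction_apply_prime_eq_one_of_hasSplitMultiplicativeReductionAtPrime W ℓ hs]
    have hc : (reductionPointCount W ℓ : ℤ) + 1 = ℓ := by exact_mod_cast hsplit hs
    unfold WeierstrassCurve.frobeniusTrace
    omega
  · rw [lFunction_apply_prime_eq_neg_one_of_not_split W ℓ h hs]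
    have hc : (reductionPointCount W ℓ : ℤ) = ℓ + 1 := by exact_mod_cast hnonsplit hs
    unfold WeierstrassCurve.frobeniusTrace
    omega

end MultiplicativePrime

end Literature.NumberTheory.EllipticCurves.KrausOesterle1992

end
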